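import Summits.QuantumFields.YangMills.Theorems.UnitScaleTiltProp7CombLadder
import HarnessLib

/-!
# Route `UnitScaleTilt`, crux K1 «MinimiserStabilityRegPr» (stmt-QuantumFields-19200), route-R E′ path (α′), S3 K-form engine, row (R4′) — FILE 9h «THE COUNT»:
# HOW MANY COMBS PASS THROUGH A GIVEN RUNG — the multiplicity bookkeeping that turns the per-comb ladder sums of ✓ `Prop7CombLadder` (one transported-plaquette
# commutator per letter of the comb's tail) into a sum over plaquettes with an explicit `(2R+1)^{…}` weight

Cell `ym3-torus`, width seat `ym3-torus-px9` (gen 3; WIDTH COPY «width 9» of ym3-torus-p1); row (R4′) lineage of `ym-routeR-w1` g6 («px9: F-H9h (THE COUNT) — GO»,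
2026-08-28 22:00Z; namer ★ym-ust-19200-p1 g15, standing PASS 21:15Z).  THEOREMS ONLY (0 `def`, 0 `sorry`); `--supports stmt-QuantumFields-19200 --as helper`, count-neutral.
YM₃ on T³ is a RUNG of the ladder (R3) — not d = 4, not infinite volume, not a mass gap, not the Clay problem; nothing here claims a stub, the crux or any summit statement.

THE POINT (routeR-w1 g6 spec 21:55Z).  In ✓ `Prop7CombLadder.comm_hol_contour27_le_of_nonneg ∕ _of_neg` the loop of (27) based at the pull-back coordinate `v ∈ ℤ^d` costs one
transported-plaquette commutator per RUNG `k < |B|` of the comb's tail `B = t.flatMap (κ ↦ seg κ (v κ))` (`t` = the directions after the rung direction `μ` in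
`(finRange d).reverse`), the `k`-th rung sitting at `base(v) + disp (B.take k)` with letter `B.getD k (μ, true)`.  Summing over the combs `v` of a box `[−R, R]^d`, a fixed
(position, letter) in the run of direction `t[i]` is met only by combs that AGREE with it on `D` and `t[0..i)` and are free later: at most `(2R+1)^{d − (|D| + i)}` of them (the
«ray multiplicity» `(6ℓ+1)^{1+#{i<dir}}` of the R4′ design at `R = 3ℓ`).  So for every nonnegative weight `f` of (position, letter) — whatever majorant the junction puts on the
`k`-th summand (majorize first, then count) — the box sum of the rung sums is at most `Σ_i (2R+1)^{d−(|D|+i)}·Σ_{q ∈ box} (f q (t[i],+) + f q (t[i],−))`.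

WHAT IS PROVED (ns `…Theorems.Prop7CombLadderCount`; letters `Site d = Fin d → ℤ`, `Letter d`, `e`, `seg`, `disp` of ✓ `B7Prop1Explicit`; the box is
`Fintype.piFinset (fun _ => Finset.Icc (−R) R)` spelled out; no definition).
* §0 BASE DICTIONARY: `disp_flatMap_seg` (`disp (l.flatMap (κ ↦ seg κ (v κ))) = (l.map (κ ↦ v κ • e κ)).sum`), `sum_map_zsmul_e_apply` (its coordinates: `v κ` on `l`, `0` off `l`),
  `disp_base_nonneg` ∕ `disp_base_neg` (the two bases of ✓ `comm_hol_contour27_le_of_nonneg ∕ _of_neg` are THE SAME point `(s.map …).sum + v μ • e μ`),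
  `length_flatMap_seg` + `length_flatMap_seg_le` ((C4): `|B| = Σ_{κ∈t}|v κ| ≤ t.length·R` on the box).
* §1 RUNG SUMS: `sum_range_rungs_append` (the rung sum of `w₁ ++ w₂` splits, the second half based at `+ disp w₁`), `disp_take_seg` ∕ `getD_seg` (the `j`-th rung of a run
  of direction `κ` sits at `(sign·j) • e κ` with letter `(κ, ±)`).
* §2 ONE RUN: ★★ `sum_box_run_le` — `Σ_{v ∈ box} Σ_{j < |v κ|} f (base_D v + rung_j) letter_j ≤ (2R+1)^{d − |D|} · Σ_{q ∈ box} (f q (κ,+) + f q (κ,−))` for `κ ∉ D`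
  (injectivity of `j ↦` rung along one run; fibre `⊆` an explicit `Fintype.piFinset`, `Fintype.card_piFinset`).
* §3 ★★★ `sum_box_sum_rungs_le` — THE COUNT by induction on `t` (determined set `D`, `t.Nodup`, `t` disjoint from `D`):
  `Σ_{v ∈ box} Σ_{k < |B|} f (base_D v + disp (B.take k)) (B.getD k (μ,true)) ≤ Σ_{i < |t|} (2R+1)^{d − (|D| + i)} · Σ_{q ∈ box} (f q (t[i],+) + f q (t[i],−))`.
* §4 ★★★ `sum_box_sum_combRungs_le` — THE COMB COROLLARY in the letters of ✓ `treeWord_split` (`h : (finRange d).reverse = s ++ μ :: t`, base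
  `disp (s.flatMap … ++ seg μ (v μ))`, exponent `t.length − i`), and `sum_box_sum_combRungs_le_of_neg` (the `_of_neg` base, same bound).
HONEST SCOPE.  Finite combinatorics on `ℤ^d` words only; no holonomy, no smallness.  The OFFSET AVERAGE over shifted bases (routeR-w1's (c3) cure, ✓ `Prop7AxialOffsetFamily`),
which improves the first run's factor, is the next file; the junction to `K_gauge` is routeR-w1's.

References: T. Bałaban, CMP 98 (1985) 17–51 [Balaban1985Averaging] ((8)–(9) pp.18–19, p.24); CMP 95 (1984) 17–40 [Balaban1984PropagatorsI] ((1.7) p.18); CMP 102 (1985)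
255–275 [Balaban1985UV3] ((27) p.263).
-/

set_option autoImplicit false

open scoped BigOperators

namespace Summit.QuantumFields.YangMills.Theorems.Prop7CombLadderCount

open Literature.MathematicalPhysics.QuantumFieldTheory.Balaban1983to89
open B7Prop1Explicit (Site Letter e e_apply disp seg disp_append disp_seg disp_replicate length_seg seg_natCast seg_negSucc)

variable {d : ℕ}

/-! ## §0 Base dictionary: displacements and lengths of the runs of a comb -/

/-- `disp` of the runs of the directions in `l`: `Σ_{κ ∈ l} v κ • e κ` (as a list sum). [cite: Balaban1984PropagatorsI, (1.7) p.18] -/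
theorem disp_flatMap_seg (l : List (Fin d)) (v : Site d) :
    disp (l.flatMap (fun κ => seg κ (v κ))) = (l.map fun κ => v κ • e κ).sum := by
  induction l with
  | nil => simp
  | cons κ l ih => rw [List.flatMap_cons, disp_append, ih, List.map_cons, List.sum_cons, disp_seg]

/-- Coordinates of `Σ_{κ ∈ l} v κ • e κ`: `v κ` for `κ ∈ l` (listed once), `0` for `κ ∉ l`. [folklore] -/
theorem sum_map_zsmul_e_apply (l : List (Fin d)) (hl : l.Nodup) (v : Site d) (κ : Fin d) :
    (l.map fun ν => v ν • e ν).sum κ = if κ ∈ l then v κ else 0 := by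
  induction l with
  | nil => simp
  | cons ν l ih =>
    have hνl : ν ∉ l := (List.nodup_cons.mp hl).1
    rw [List.map_cons, List.sum_cons, Pi.add_apply, ih (List.nodup_cons.mp hl).2, Pi.smul_apply, e_apply, smul_eq_mul]
    by_cases hκν : κ = ν
    · subst hκν; simp [hνl]
    · have : (κ ∈ ν :: l) ↔ κ ∈ l := by simp [hκν]
      simp only [hκν, if_false, mul_zero, zero_add, this]

/-- Coordinates of the finset form `Σ_{ν ∈ D} v ν • e ν`: `v κ` on `D`, `0` off `D`. [folklore] -/
theorem sum_zsmul_e_apply (D : Finset (Fin d)) (v : Site d) (κ : Fin d) :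
    (∑ ν ∈ D, v ν • e ν) κ = if κ ∈ D then v κ else 0 := by
  rw [Finset.sum_apply]
  simp_rw [Pi.smul_apply, e_apply, smul_eq_mul, mul_ite, mul_one, mul_zero]
  exact Finset.sum_ite_eq D κ v

/-- The list form equals the finset form for a duplicate-free list. [folklore] -/
theorem sum_map_zsmul_e_eq (l : List (Fin d)) (hl : l.Nodup) (v : Site d) :
    (l.map fun ν => v ν • e ν).sum = ∑ ν ∈ l.toFinset, v ν • e ν := by
  funext κ
  rw [sum_map_zsmul_e_apply l hl v κ, sum_zsmul_e_apply]
  simp only [List.mem_toFinset]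

/-- THE NONNEG BASE of ✓ `comm_hol_contour27_le_of_nonneg`: `disp (A ++ seg μ (v μ)) = Σ_{κ∈s} v κ • e κ + v μ • e μ`. [cite: Balaban1985UV3, (27) p.263] -/
theorem disp_base_nonneg (s : List (Fin d)) (μ : Fin d) (v : Site d) :
    disp (s.flatMap (fun κ => seg κ (v κ)) ++ seg μ (v μ)) = (s.map fun κ => v κ • e κ).sum + v μ • e μ := by
  rw [disp_append, disp_flatMap_seg, disp_seg]

/-- THE NEG BASE of ✓ `comm_hol_contour27_le_of_neg` is the same point: `disp (A ++ seg μ (v μ + 1)) − e μ = Σ_{κ∈s} v κ • e κ + v μ • e μ`. [cite: Balaban1985UV3, (27) p.263] -/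
theorem disp_base_neg (s : List (Fin d)) (μ : Fin d) (v : Site d) :
    disp (s.flatMap (fun κ => seg κ (v κ)) ++ seg μ (v μ + 1)) - e μ = (s.map fun κ => v κ • e κ).sum + v μ • e μ := by
  rw [disp_append, disp_flatMap_seg, disp_seg, add_smul, one_smul]
  abel

/-- (C4) THE LENGTH OF THE TAIL: `|t.flatMap (κ ↦ seg κ (v κ))| = Σ_{κ ∈ t} |v κ|`. [cite: Balaban1985Averaging, p.24] -/
theorem length_flatMap_seg (l : List (Fin d)) (v : Site d) :
    (l.flatMap (fun κ => seg κ (v κ))).length = (l.map fun κ => (v κ).natAbs).sum := by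
  induction l with
  | nil => simp
  | cons κ l ih => rw [List.flatMap_cons, List.length_append, ih, List.map_cons, List.sum_cons, length_seg]

/-- (C4′) … hence `≤ t.length · R` for `v` in the box `[−R, R]^d`. [cite: Balaban1985Averaging, p.24] -/
theorem length_flatMap_seg_le (l : List (Fin d)) (R : ℕ) (v : Site d)
    (hv : v ∈ Fintype.piFinset fun _ : Fin d => Finset.Icc (-(R : ℤ)) (R : ℤ)) :
    (l.flatMap (fun κ => seg κ (v κ))).length ≤ l.length * R := by
  rw [length_flatMap_seg]
  have hb : ∀ κ, (v κ).natAbs ≤ R := fun κ => by have h := Finset.mem_Icc.mp (Fintype.mem_piFinset.mp hv κ); omega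
  induction l with
  | nil => simp
  | cons κ l ih => rw [List.map_cons, List.sum_cons, List.length_cons]; nlinarith [ih, hb κ]

/-! ## §1 Rung sums: splitting at an append, and the rungs of one run -/

/-- THE RUNG SUM OF `w₁ ++ w₂` SPLITS: the rungs of `w₂` are based at `p + disp w₁`. [folklore] -/
theorem sum_range_rungs_append {M : Type*} [AddCommMonoid M] (g : Site d → Letter d → M) (dflt : Letter d) (p : Site d)
    (w₁ w₂ : List (Letter d)) :
    ∑ k ∈ Finset.range (w₁ ++ w₂).length, g (p + disp ((w₁ ++ w₂).take k)) ((w₁ ++ w₂).getD k dflt)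
      = ∑ k ∈ Finset.range w₁.length, g (p + disp (w₁.take k)) (w₁.getD k dflt)
        + ∑ k ∈ Finset.range w₂.length, g (p + disp w₁ + disp (w₂.take k)) (w₂.getD k dflt) := by
  rw [List.length_append, Finset.sum_range_add]
  congr 1
  · refine Finset.sum_congr rfl fun k hk => ?_
    have hk' : k < w₁.length := Finset.mem_range.mp hk
    rw [List.take_append_of_le_length hk'.le, List.getD_eq_getElem?_getD, List.getD_eq_getElem?_getD,
      List.getElem?_append_left hk']
  · refine Finset.sum_congr rfl fun k _ => ?_
    rw [List.take_length_add_append, disp_append, add_assoc, List.getD_eq_getElem?_getD, List.getD_eq_getElem?_getD,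
      List.getElem?_append_right (Nat.le_add_right _ _), Nat.add_sub_cancel_left]

/-- THE `j`-TH RUNG OF A RUN: `disp ((seg κ n).take j) = (sign n · j) • e κ` for `j ≤ |n|`. [cite: Balaban1985Averaging, p.24] -/
theorem disp_take_seg (κ : Fin d) (n : ℤ) (j : ℕ) (hj : j ≤ n.natAbs) :
    disp ((seg κ n).take j) = (n.sign * (j : ℤ)) • e κ := by
  cases n with
  | ofNat m =>
    rw [Int.ofNat_eq_natCast, seg_natCast, List.take_replicate, Nat.min_eq_left (by simpa using hj), disp_replicate,
      B7Prop1Explicit.Letter.vec_true]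
    rcases Nat.eq_zero_or_pos m with hm | hm
    · subst hm
      have : j = 0 := by simpa using hj
      subst this; simp
    · rw [Int.sign_natCast_of_ne_zero hm.ne', one_mul]
  | negSucc m =>
    rw [seg_negSucc, List.take_replicate, Nat.min_eq_left (by simpa using hj), disp_replicate, B7Prop1Explicit.Letter.vec_false,
      Int.sign_negSucc, smul_neg, ← neg_smul, neg_mul, one_mul]

/-- THE LETTER OF THE `j`-TH RUNG OF A RUN: `(κ, true)` for `n ≥ 0`, `(κ, false)` for `n < 0` (`j < |n|`). [cite: Balaban1985Averaging, p.24] -/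
theorem getD_seg (κ : Fin d) (n : ℤ) (j : ℕ) (hj : j < n.natAbs) (dflt : Letter d) :
    (seg κ n).getD j dflt = (κ, true) ∨ (seg κ n).getD j dflt = (κ, false) := by
  cases n with
  | ofNat m =>
    left
    rw [Int.ofNat_eq_natCast, seg_natCast, List.getD_eq_getElem?_getD, List.getElem?_replicate, if_pos (by simpa using hj), Option.getD_some]
  | negSucc m =>
    right; rw [seg_negSucc, List.getD_eq_getElem?_getD, List.getElem?_replicate, if_pos (by simpa using hj), Option.getD_some]

/-! ## §2 One run: every (position, letter) of the run of direction `κ ∉ D` is met by at most `(2R+1)^{d − |D|}` combs of the box -/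

/-- Membership in the box `[−R, R]^d`, coordinatewise. [folklore] -/
theorem mem_box_iff {R : ℕ} {v : Site d} :
    v ∈ Fintype.piFinset (fun _ : Fin d => Finset.Icc (-(R : ℤ)) (R : ℤ)) ↔ ∀ κ, -(R : ℤ) ≤ v κ ∧ v κ ≤ R := by
  simp [Fintype.mem_piFinset, Finset.mem_Icc]

/-- THE FIBRE BOUND: the points of the box agreeing with `q` on `D` number at most `(2R+1)^(d − |D|)` (an explicit product box, `Fintype.card_piFinset`). [folklore] -/
theorem card_filter_agree_le (R : ℕ) (D : Finset (Fin d)) (q : Site d) :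
    ((Fintype.piFinset (fun _ : Fin d => Finset.Icc (-(R : ℤ)) (R : ℤ))).filter (fun v => ∀ ν ∈ D, q ν = v ν)).card
      ≤ (2 * R + 1) ^ (d - D.card) := by
  classical
  calc ((Fintype.piFinset (fun _ : Fin d => Finset.Icc (-(R : ℤ)) (R : ℤ))).filter (fun v => ∀ ν ∈ D, q ν = v ν)).card
      ≤ (Fintype.piFinset (fun ν : Fin d => if ν ∈ D then ({q ν} : Finset ℤ) else Finset.Icc (-(R : ℤ)) (R : ℤ))).card := by
        refine Finset.card_le_card fun v hv => ?_
        rw [Finset.mem_filter] at hv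
        rw [Fintype.mem_piFinset]
        intro ν
        by_cases hν : ν ∈ D
        · rw [if_pos hν, Finset.mem_singleton]
          exact (hv.2 ν hν).symm
        · rw [if_neg hν]
          exact Fintype.mem_piFinset.mp hv.1 ν
    _ = ∏ ν : Fin d, (if ν ∈ D then ({q ν} : Finset ℤ) else Finset.Icc (-(R : ℤ)) (R : ℤ)).card := Fintype.card_piFinset _
    _ = ∏ ν : Fin d, (if ν ∈ Dᶜ then (2 * R + 1) else 1) := by
        refine Finset.prod_congr rfl fun ν _ => ?_
        by_cases hν : ν ∈ D
        · rw [if_pos hν, Finset.card_singleton, if_neg (fun h => Finset.mem_compl.mp h hν)]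
        · rw [if_neg hν, if_pos (Finset.mem_compl.mpr hν), Int.card_Icc]
          have : ((R : ℤ) + 1 - -(R : ℤ)) = ((2 * R + 1 : ℕ) : ℤ) := by push_cast; ring
          rw [this, Int.toNat_natCast]
    _ = (2 * R + 1) ^ (d - D.card) := by
        rw [Finset.prod_ite_mem, Finset.univ_inter, Finset.prod_const, Finset.card_compl, Fintype.card_fin]

/-- STEP A (one comb, one run): the rungs of the run of direction `κ` of the comb based at `Σ_{ν∈D} v ν • e ν` (`κ ∉ D`) are DISTINCT points of the box agreeing with `v` on `D`,
so their `f`-sum is at most the sum of `f q (κ,+) + f q (κ,−)` over those points (`f ≥ 0`). [cite: Balaban1985Averaging, p.24] -/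
theorem sum_run_le_sum_agree (R : ℕ) (D : Finset (Fin d)) (κ : Fin d) (hκ : κ ∉ D) (dflt : Letter d)
    (f : Site d → Letter d → ℝ) (hf : ∀ q b, 0 ≤ f q b) (v : Site d)
    (hv : v ∈ Fintype.piFinset (fun _ : Fin d => Finset.Icc (-(R : ℤ)) (R : ℤ))) :
    ∑ j ∈ Finset.range (seg κ (v κ)).length, f ((∑ ν ∈ D, v ν • e ν) + disp ((seg κ (v κ)).take j)) ((seg κ (v κ)).getD j dflt)
      ≤ ∑ q ∈ (Fintype.piFinset (fun _ : Fin d => Finset.Icc (-(R : ℤ)) (R : ℤ))).filter (fun q => ∀ ν ∈ D, q ν = v ν),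
          (f q (κ, true) + f q (κ, false)) := by
  classical
  rw [length_seg]
  have hvb := (mem_box_iff (R := R)).mp hv
  -- the rung positions
  have hpos : ∀ j ∈ Finset.range (v κ).natAbs,
      (∑ ν ∈ D, v ν • e ν) + disp ((seg κ (v κ)).take j) = (∑ ν ∈ D, v ν • e ν) + ((v κ).sign * (j : ℤ)) • e κ := by
    intro j hj
    rw [disp_take_seg κ (v κ) j (Finset.mem_range.mp hj).le]
  -- coordinates of a rung position
  have hcoord : ∀ (j : ℕ) (ν : Fin d), ((∑ ν ∈ D, v ν • e ν) + ((v κ).sign * (j : ℤ)) • e κ) ν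
      = if ν ∈ D then v ν else if ν = κ then (v κ).sign * (j : ℤ) else 0 := by
    intro j ν
    rw [Pi.add_apply, sum_zsmul_e_apply, Pi.smul_apply, e_apply, smul_eq_mul]
    by_cases hνD : ν ∈ D
    · have hνκ : ν ≠ κ := fun h => hκ (h ▸ hνD)
      simp [hνD, hνκ]
    · by_cases hνκ : ν = κ
      · subst hνκ; simp [hκ]
      · simp [hνD, hνκ]
  -- step 1: majorize each summand by `F` of its position
  calc ∑ j ∈ Finset.range (v κ).natAbs, f ((∑ ν ∈ D, v ν • e ν) + disp ((seg κ (v κ)).take j)) ((seg κ (v κ)).getD j dflt)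
      ≤ ∑ j ∈ Finset.range (v κ).natAbs, (f ((∑ ν ∈ D, v ν • e ν) + ((v κ).sign * (j : ℤ)) • e κ) (κ, true)
          + f ((∑ ν ∈ D, v ν • e ν) + ((v κ).sign * (j : ℤ)) • e κ) (κ, false)) := by
        refine Finset.sum_le_sum fun j hj => ?_
        rw [hpos j hj]
        rcases getD_seg κ (v κ) j (Finset.mem_range.mp hj) dflt with h | h <;> rw [h]
        · exact le_add_of_nonneg_right (hf _ _)
        · exact le_add_of_nonneg_left (hf _ _)
    _ = ∑ q ∈ (Finset.range (v κ).natAbs).image (fun j : ℕ => (∑ ν ∈ D, v ν • e ν) + ((v κ).sign * (j : ℤ)) • e κ),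
          (f q (κ, true) + f q (κ, false)) := by
        rw [Finset.sum_image]
        -- injectivity of `j ↦ position` along the run (read the `κ`-coordinate)
        intro j₁ hj₁ j₂ hj₂ hEq
        have hne : v κ ≠ 0 := by
          intro h0
          have := Finset.mem_range.mp (Finset.mem_coe.mp hj₁)
          rw [h0] at this
          simp at this
        have h := congrArg (fun p : Site d => p κ) hEq
        simp only [hcoord, hκ, if_false, if_true] at h
        have hs : (v κ).sign ≠ 0 := fun h0 => hne (Int.sign_eq_zero_iff_zero.mp h0)
        exact_mod_cast mul_left_cancel₀ hs h
    _ ≤ _ := by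
        refine Finset.sum_le_sum_of_subset_of_nonneg (fun q hq => ?_) (fun q _ _ => add_nonneg (hf _ _) (hf _ _))
        rw [Finset.mem_image] at hq
        obtain ⟨j, hj, rfl⟩ := hq
        have hjR : ((j : ℕ) : ℤ) ≤ R := by
          have h1 := Finset.mem_range.mp hj
          have h2 := hvb κ
          omega
        rw [Finset.mem_filter, mem_box_iff]
        refine ⟨fun ν => ?_, fun ν hν => ?_⟩
        · rw [hcoord]
          by_cases hνD : ν ∈ D
          · rw [if_pos hνD]; exact hvb ν
          · rw [if_neg hνD]
            by_cases hνκ : ν = κ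
            · rw [if_pos hνκ]
              rcases Int.sign_trichotomy (v κ) with hs | hs | hs <;> rw [hs] <;> constructor <;> omega
            · rw [if_neg hνκ]; constructor <;> omega
        · rw [hcoord, if_pos hν]

/-- ★★ STEP B (all combs, one run): `Σ_{v ∈ box} Σ_{j < |v κ|} f (base_D v + rung_j) letter_j ≤ (2R+1)^{d − |D|} · Σ_{q ∈ box} (f q (κ,+) + f q (κ,−))` for `κ ∉ D` —
swap the sums and bound the fibre by `card_filter_agree_le`. [cite: Balaban1985Averaging, (8)-(9) pp.18-19, p.24] -/
theorem sum_box_run_le (R : ℕ) (D : Finset (Fin d)) (κ : Fin d) (hκ : κ ∉ D) (dflt : Letter d)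
    (f : Site d → Letter d → ℝ) (hf : ∀ q b, 0 ≤ f q b) :
    ∑ v ∈ Fintype.piFinset (fun _ : Fin d => Finset.Icc (-(R : ℤ)) (R : ℤ)),
        ∑ j ∈ Finset.range (seg κ (v κ)).length, f ((∑ ν ∈ D, v ν • e ν) + disp ((seg κ (v κ)).take j)) ((seg κ (v κ)).getD j dflt)
      ≤ (((2 * R + 1) ^ (d - D.card) : ℕ) : ℝ)
        * ∑ q ∈ Fintype.piFinset (fun _ : Fin d => Finset.Icc (-(R : ℤ)) (R : ℤ)), (f q (κ, true) + f q (κ, false)) := by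
  classical
  set box := Fintype.piFinset (fun _ : Fin d => Finset.Icc (-(R : ℤ)) (R : ℤ)) with hbox
  have hF : ∀ q, 0 ≤ f q (κ, true) + f q (κ, false) := fun q => add_nonneg (hf _ _) (hf _ _)
  calc ∑ v ∈ box, ∑ j ∈ Finset.range (seg κ (v κ)).length, f ((∑ ν ∈ D, v ν • e ν) + disp ((seg κ (v κ)).take j)) ((seg κ (v κ)).getD j dflt)
      ≤ ∑ v ∈ box, ∑ q ∈ box.filter (fun q => ∀ ν ∈ D, q ν = v ν), (f q (κ, true) + f q (κ, false)) :=
        Finset.sum_le_sum fun v hv => sum_run_le_sum_agree R D κ hκ dflt f hf v hv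
    _ = ∑ v ∈ box, ∑ q ∈ box, (if (∀ ν ∈ D, q ν = v ν) then (f q (κ, true) + f q (κ, false)) else 0) := by
        refine Finset.sum_congr rfl fun v _ => ?_
        rw [Finset.sum_filter]
    _ = ∑ q ∈ box, ∑ v ∈ box, (if (∀ ν ∈ D, q ν = v ν) then (f q (κ, true) + f q (κ, false)) else 0) := Finset.sum_comm
    _ = ∑ q ∈ box, ((box.filter (fun v => ∀ ν ∈ D, q ν = v ν)).card : ℝ) * (f q (κ, true) + f q (κ, false)) := by
        refine Finset.sum_congr rfl fun q _ => ?_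
        rw [← Finset.sum_filter, Finset.sum_const, nsmul_eq_mul]
    _ ≤ ∑ q ∈ box, (((2 * R + 1) ^ (d - D.card) : ℕ) : ℝ) * (f q (κ, true) + f q (κ, false)) := by
        refine Finset.sum_le_sum fun q _ => mul_le_mul_of_nonneg_right ?_ (hF q)
        exact_mod_cast card_filter_agree_le R D q
    _ = _ := by rw [← Finset.mul_sum]

/-! ## §3 THE COUNT: induction over the runs of the tail -/

/-- ★★★ **THE COUNT.**  For a duplicate-free list `t` of directions disjoint from the determined set `D`, every nonnegative weight `f` of (position, letter), and the box
`[−R, R]^d`: the box sum of the rung sums of the tails `B(v) = t.flatMap (κ ↦ seg κ (v κ))` based at `Σ_{ν∈D} v ν • e ν` is at most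
`Σ_{i < |t|} (2R+1)^{d − (|D| + i)} · Σ_{q ∈ box} (f q (t[i],+) + f q (t[i],−))` — the `i`-th run's rungs are met by the combs fixed on `D ∪ t[0..i)` and free later.
[cite: Balaban1985Averaging, (8)-(9) pp.18-19, p.24; Balaban1985UV3, (27) p.263] -/
theorem sum_box_sum_rungs_le (R : ℕ) (dflt : Letter d) (κ₀ : Fin d) (f : Site d → Letter d → ℝ) (hf : ∀ q b, 0 ≤ f q b) :
    ∀ (t : List (Fin d)) (D : Finset (Fin d)), t.Nodup → (∀ κ ∈ t, κ ∉ D) →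
      ∑ v ∈ Fintype.piFinset (fun _ : Fin d => Finset.Icc (-(R : ℤ)) (R : ℤ)),
          ∑ k ∈ Finset.range (t.flatMap (fun κ => seg κ (v κ))).length,
            f ((∑ ν ∈ D, v ν • e ν) + disp ((t.flatMap (fun κ => seg κ (v κ))).take k)) ((t.flatMap (fun κ => seg κ (v κ))).getD k dflt)
        ≤ ∑ i ∈ Finset.range t.length, (((2 * R + 1) ^ (d - (D.card + i)) : ℕ) : ℝ)
            * ∑ q ∈ Fintype.piFinset (fun _ : Fin d => Finset.Icc (-(R : ℤ)) (R : ℤ)), (f q (t.getD i κ₀, true) + f q (t.getD i κ₀, false))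
  | [], D, _, _ => by simp
  | κ :: t, D, hnd, hD => by
    classical
    have hκD : κ ∉ D := hD κ (by simp)
    have hκt : κ ∉ t := (List.nodup_cons.mp hnd).1
    have hnd' : t.Nodup := (List.nodup_cons.mp hnd).2
    have hD' : ∀ κ' ∈ t, κ' ∉ insert κ D := by
      intro κ' hκ' h
      rcases Finset.mem_insert.mp h with h | h
      · exact hκt (h ▸ hκ')
      · exact hD κ' (by simp [hκ']) h
    have ih := sum_box_sum_rungs_le R dflt κ₀ f hf t (insert κ D) hnd' hD'
    -- split each comb's rung sum at the end of the first run
    have hsplit : ∀ v : Site d,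
        ∑ k ∈ Finset.range ((κ :: t).flatMap (fun κ => seg κ (v κ))).length,
            f ((∑ ν ∈ D, v ν • e ν) + disp (((κ :: t).flatMap (fun κ => seg κ (v κ))).take k)) (((κ :: t).flatMap (fun κ => seg κ (v κ))).getD k dflt)
          = ∑ j ∈ Finset.range (seg κ (v κ)).length, f ((∑ ν ∈ D, v ν • e ν) + disp ((seg κ (v κ)).take j)) ((seg κ (v κ)).getD j dflt)
            + ∑ k ∈ Finset.range (t.flatMap (fun κ => seg κ (v κ))).length,
                f ((∑ ν ∈ insert κ D, v ν • e ν) + disp ((t.flatMap (fun κ => seg κ (v κ))).take k)) ((t.flatMap (fun κ => seg κ (v κ))).getD k dflt) := by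
      intro v
      rw [List.flatMap_cons, sum_range_rungs_append f dflt _ (seg κ (v κ)) _, disp_seg, Finset.sum_insert hκD, add_comm (v κ • e κ)]
    rw [Finset.sum_congr rfl fun v _ => hsplit v, Finset.sum_add_distrib, List.length_cons, Finset.sum_range_succ', List.getD_cons_zero,
      Nat.add_zero]
    have hrun := sum_box_run_le R D κ hκD dflt f hf
    have hrest := ih.trans (le_of_eq (Finset.sum_congr rfl fun i (_ : i ∈ Finset.range t.length) =>
      show (((2 * R + 1) ^ (d - ((insert κ D).card + i)) : ℕ) : ℝ)
            * ∑ q ∈ Fintype.piFinset (fun _ : Fin d => Finset.Icc (-(R : ℤ)) (R : ℤ)), (f q (t.getD i κ₀, true) + f q (t.getD i κ₀, false))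
          = (((2 * R + 1) ^ (d - (D.card + (i + 1))) : ℕ) : ℝ)
            * ∑ q ∈ Fintype.piFinset (fun _ : Fin d => Finset.Icc (-(R : ℤ)) (R : ℤ)), (f q ((κ :: t).getD (i + 1) κ₀, true) + f q ((κ :: t).getD (i + 1) κ₀, false)) by
        rw [List.getD_cons_succ, Finset.card_insert_of_notMem hκD, show D.card + 1 + i = D.card + (i + 1) by ring]))
    exact (add_le_add hrun hrest).trans_eq (add_comm _ _)

/-! ## §4 The comb corollary in the letters of ✓ `Prop7CombLadder.treeWord_split` -/

/-- bookkeeping of the split `(finRange d).reverse = s ++ μ :: t`: no duplicates anywhere, and `d = |s| + 1 + |t|`. [folklore] -/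
theorem split_nodup (μ : Fin d) {s t : List (Fin d)} (h : (List.finRange d).reverse = s ++ μ :: t) :
    s.Nodup ∧ t.Nodup ∧ μ ∉ s ∧ μ ∉ t ∧ (∀ κ ∈ t, κ ∉ s) ∧ d = s.length + 1 + t.length := by
  have hnd : (s ++ μ :: t).Nodup := h ▸ (List.nodup_reverse.mpr (List.nodup_finRange d))
  have hlen : d = s.length + 1 + t.length := by
    have := congrArg List.length h
    rw [List.length_reverse, List.length_finRange, List.length_append, List.length_cons] at this
    omega
  rw [List.nodup_append] at hnd
  obtain ⟨hs, hμt, hx⟩ := hnd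
  rw [List.nodup_cons] at hμt
  refine ⟨hs, hμt.2, fun hμs => hx μ hμs μ (by simp) rfl, hμt.1, fun κ hκ hκs => hx κ hκs κ (by simp [hκ]) rfl, hlen⟩

/-- the base of the comb split as a finset sum: `disp (s.flatMap … ++ seg μ (v μ)) = Σ_{ν ∈ insert μ s.toFinset} v ν • e ν`. [cite: Balaban1985UV3, (27) p.263] -/
theorem disp_base_eq_sum (μ : Fin d) {s t : List (Fin d)} (h : (List.finRange d).reverse = s ++ μ :: t) (v : Site d) :
    disp (s.flatMap (fun κ => seg κ (v κ)) ++ seg μ (v μ)) = ∑ ν ∈ insert μ s.toFinset, v ν • e ν := by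
  classical
  obtain ⟨hs, -, hμs, -⟩ := split_nodup μ h
  rw [disp_base_nonneg, sum_map_zsmul_e_eq s hs, Finset.sum_insert (fun h' => hμs (List.mem_toFinset.mp h')), add_comm]

/-- ★★★ **THE COMB COROLLARY** (nonneg base of ✓ `comm_hol_contour27_le_of_nonneg`): for the split `(finRange d).reverse = s ++ μ :: t`, every nonnegative weight `f` and the box
`[−R, R]^d`, `Σ_{v ∈ box} Σ_{k < |B|} f (disp (A ++ seg μ (v μ)) + disp (B.take k)) (B.getD k (μ,true)) ≤ Σ_{i < |t|} (2R+1)^{|t| − i} · Σ_{q ∈ box} (f q (t[i],+) + f q (t[i],−))`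
(`A`, `B` the runs before∕after `μ`; for the standard order `t = [μ−1, …, 0]` the exponent is `t[i] + 1`). [cite: Balaban1985UV3, (27) p.263; Balaban1985Averaging, p.24] -/
theorem sum_box_sum_combRungs_le (R : ℕ) (μ : Fin d) {s t : List (Fin d)} (h : (List.finRange d).reverse = s ++ μ :: t)
    (f : Site d → Letter d → ℝ) (hf : ∀ q b, 0 ≤ f q b) :
    ∑ v ∈ Fintype.piFinset (fun _ : Fin d => Finset.Icc (-(R : ℤ)) (R : ℤ)),
        ∑ k ∈ Finset.range (t.flatMap (fun κ => seg κ (v κ))).length,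
          f (disp (s.flatMap (fun κ => seg κ (v κ)) ++ seg μ (v μ)) + disp ((t.flatMap (fun κ => seg κ (v κ))).take k))
            ((t.flatMap (fun κ => seg κ (v κ))).getD k (μ, true))
      ≤ ∑ i ∈ Finset.range t.length, (((2 * R + 1) ^ (t.length - i) : ℕ) : ℝ)
          * ∑ q ∈ Fintype.piFinset (fun _ : Fin d => Finset.Icc (-(R : ℤ)) (R : ℤ)), (f q (t.getD i μ, true) + f q (t.getD i μ, false)) := by
  classical
  obtain ⟨hs, ht, hμs, -, hts, hlen⟩ := split_nodup μ h
  have hD : ∀ κ ∈ t, κ ∉ insert μ s.toFinset := by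
    intro κ hκ hmem
    rcases Finset.mem_insert.mp hmem with h1 | h1
    · obtain ⟨-, -, -, hμt, -⟩ := split_nodup μ h
      exact hμt (h1 ▸ hκ)
    · exact hts κ hκ (List.mem_toFinset.mp h1)
  have hcard : (insert μ s.toFinset).card = s.length + 1 := by
    rw [Finset.card_insert_of_notMem (fun h' => hμs (List.mem_toFinset.mp h')), List.toFinset_card_of_nodup hs]
  have main := sum_box_sum_rungs_le R (μ, true) μ f hf t (insert μ s.toFinset) ht hD
  simp_rw [disp_base_eq_sum μ h]
  refine main.trans (le_of_eq (Finset.sum_congr rfl fun i hi => ?_))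
  have hi' := Finset.mem_range.mp hi
  rw [hcard, show d - (s.length + 1 + i) = t.length - i by omega]

/-- ★★★ **THE COMB COROLLARY, `_of_neg` base** (`disp (A ++ seg μ (v μ + 1)) − e μ`, the letters of ✓ `comm_hol_contour27_le_of_neg`): the same bound.
[cite: Balaban1985UV3, (27) p.263; Balaban1985Averaging, p.24] -/
theorem sum_box_sum_combRungs_le_of_neg (R : ℕ) (μ : Fin d) {s t : List (Fin d)} (h : (List.finRange d).reverse = s ++ μ :: t)
    (f : Site d → Letter d → ℝ) (hf : ∀ q b, 0 ≤ f q b) :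
    ∑ v ∈ Fintype.piFinset (fun _ : Fin d => Finset.Icc (-(R : ℤ)) (R : ℤ)),
        ∑ k ∈ Finset.range (t.flatMap (fun κ => seg κ (v κ))).length,
          f (disp (s.flatMap (fun κ => seg κ (v κ)) ++ seg μ (v μ + 1)) - e μ + disp ((t.flatMap (fun κ => seg κ (v κ))).take k))
            ((t.flatMap (fun κ => seg κ (v κ))).getD k (μ, true))
      ≤ ∑ i ∈ Finset.range t.length, (((2 * R + 1) ^ (t.length - i) : ℕ) : ℝ)
          * ∑ q ∈ Fintype.piFinset (fun _ : Fin d => Finset.Icc (-(R : ℤ)) (R : ℤ)), (f q (t.getD i μ, true) + f q (t.getD i μ, false)) := by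
  have e1 : ∀ v : Site d, disp (s.flatMap (fun κ => seg κ (v κ)) ++ seg μ (v μ + 1)) - e μ = disp (s.flatMap (fun κ => seg κ (v κ)) ++ seg μ (v μ)) :=
    fun v => by rw [disp_base_neg, disp_base_nonneg]
  simp_rw [e1]
  exact sum_box_sum_combRungs_le R μ h f hf

end Summit.QuantumFields.YangMills.Theorems.Prop7CombLadderCount
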